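import Summits.CriticalPhenomena.PercolationContinuityZ3.Theorems.PercAnnulusCrossingSlabMSFLandingW
import Literature.Probability.Percolation.LabelAffineRelabel
import HarnessLib

/-!
# RSW3 lane (lead, gen 45): NTW 2017 §4 — THE SURGERY OF THE GLUING LEMMA FOR INVASION ON ONE PIECE: the relabelled field
# lands in `𝓑_0 ∩ 𝓑_x ∩ C ∩ D′` with the same `Γ_min`, the same landing vertex and the same modified set (file F6 of the
# build-out of Theorem 2.4)

builds on p205010 (kernel theorem, internal audit signed; external expert review pending) — NOT used in this file.

Cell `prim-rsw3`, lead seat (gen 45), blueprint `prim-rsw3-lead/gen44/BUILDOUT-PLAN.md` §3.  Support file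
(`--supports stmt-CriticalPhenomena-4575`); no definitions, no named facts, no sorries.

Newman–Tassion–Wu (arXiv:1512.09107, §4.1, proof of Lemma 4.1, p. 21): «We now construct `ω′ = Φ(ω)` as follows. Step 1. Open
all the edges in `Γ_z` (that is, take `ω(e) ↦ p_c ω(e)`). Step 2. … If `w ∉ C_{p_c}(z)` … Open all the edges in `Γ_w`. Step 3.
Close all the edges in `B̄₁^#(z′)` (that is, map `ω(e) ↦ b + (1-b)ω(e)` with `b > p_c`) except for the edges of
`Γ_min(ω) ∪ Γ_z ∪ Γ_w`. By construction, `ω′ ∈ 𝓑_0^{m_i} ∩ 𝓑_x^{m_i} ∩ 𝒴_A^i` … `Γ_min(ω′) = Γ_min(ω)` … `z(ω) = z(ω′)` …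
`S(ω′) = B̄₁^#(z′) ∖ Γ_min(ω′)`.»

In the tree's vocabulary the map on ONE piece is the affine relabelling `T = NTW17.affineRelabel p b S L` of
`LabelAffineRelabel.lean` with `S = surgFin k Γ z′` (the modified pairs) and `L = edgesFin (Γ_z)` (Steps 1+3) or
`edgesFin (Γ_z) ∪ edgesFin (Γ_w)` (Steps 1+2+3), where `Γ = minCircuit` of the label configuration `η_p(U)`, `z = zHat`,
`w = wHat` (`SlabMSFLanding.lean`); the Step-2 test is read after Steps 1 and 3 (reading (R2′) of the lane's memo):
"`Γ_w` is added iff no vertex of `Γ` is joined to `w` in `cfgZ`".  For a `[0,1]`-valued field `U` on the piece, this file proves: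

* `configOfLabels_affineRelabel_eq` — the abstract dictionary "lowered pairs open at level `p`, raised pairs closed, the rest
  unchanged", and its instances **`configOfLabels_surgeryZ`** (`η_p(T U) = cfgZ`) / **`configOfLabels_surgeryZW`** (`= cfgZW`);
* **`surgeryZ_spec`** (Steps 1+3, on `(𝓑_a)^c ∩ C ∩ D′`): `η_p(T U) ∈ C`, `∈ D′`, `Γ_min(η_p(T U)) = Γ`, `zHat (T U) = zHat U`,
  and **`𝓑_a(T U)`** (the landing vertex is joined to `Γ` along `Γ_z`, and blocked absorption puts `V(Γ)` in `𝓘_a^M`);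
  `surgeryZ_Bx` — `𝓑_x(T U)` when `𝓑_x(U)` holds and the Step-2 test fails (some vertex of `Γ` is `cfgZ`-joined to `w`);
* **`surgeryZW_spec`** (Steps 1+2+3, when the test holds): the same conclusions together with `𝓑_x(T U)`, `w` being joined
  to `Γ` along `Γ_w` and then `Γ_z` (`exists_reachable_cfgZW`);
* bookkeeping for Lemma 4.2: `T U` is `[0,1]`-valued, agrees with `U` off `S`, and `L ⊆ S` (`edgesFin_gammaZ_subset_surgFin`,
  `edgesFin_gammaZW_subset_surgFin`).
Conventions: `Λ_M = ballFinset k 0 M` with `M = m_i - 1`, `N = 2n_i`, `D′ = {η ∉ B_{N+1} ⟷^{B_{M+1}} ∂B_{M+1}}` (repair (R1)),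
`N + 1 ≤ M`; the roots satisfy `ā, x̄ ∈ B_{n-1}` (so they lie in `R ∖ ∂R` and off every plus cylinder about a column of `Γ`).

References: C. M. Newman, V. Tassion, W. Wu, *Critical percolation and the minimal spanning tree in slabs*, CPAM 70 (2017),
arXiv:1512.09107, §4.1 pp. 20–21 [NewmanTassionWu2017].
-/

noncomputable section

namespace Summit.CriticalPhenomena.PercolationContinuityZ3.Theorems.Crossing

open Literature.Probability.Percolation Literature.Probability.LatticeModels
open Literature.Probability.Percolation.NTW17 Literature.Probability.Percolation.Invasion

variable {k : ℕ}

/-! ## The dictionary between the relabelling and the surgered configuration -/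

/-- **Lowered pairs are open at level `p`, raised pairs are closed, the rest is unchanged.**  If `ω'` agrees with `η_p(U)` off
`S`, contains `L`, and contains no pair of `S ∖ L`, then `η_p(T_{S,L} U) = ω'` for a `[0,1]`-valued field `U`
(`0 ≤ p < b ≤ 1`, `S` a set of graph pairs). [cite: NewmanTassionWu2017, §4.1 (proof of Lemma 4.1, Steps 1–3: "ω(e) ↦ p_c ω(e)", "ω(e) ↦ b + (1-b)ω(e) with b > p_c")] -/
theorem configOfLabels_affineRelabel_eq {p b : ℝ} (hp : 0 ≤ p) (hpb : p < b) (hb1 : b ≤ 1)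
    {U : Sym2 (slab 3 k) → ℝ} (h01 : ∀ e, U e ∈ Set.Icc (0 : ℝ) 1) {S L : Finset (Sym2 (slab 3 k))}
    {ω' : BondConfig (slab 3 k)} (hSE : ∀ e ∈ S, e ∈ (slabGraph 3 k).edgeSet)
    (hoff : ∀ e, e ∉ S → (e ∈ ω' ↔ e ∈ configOfLabels p U (slabGraph 3 k)))
    (hL : ∀ e ∈ L, e ∈ S → e ∈ ω') (hSL : ∀ e ∈ S, e ∉ L → e ∉ ω') :
    configOfLabels p (affineRelabel p b S L U) (slabGraph 3 k) = ω' := by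
  ext e
  by_cases heS : e ∈ S
  · by_cases heL : e ∈ L
    · exact ⟨fun _ => hL e heL heS,
        fun _ => mem_configOfLabels_affineRelabel_of_mem_of_mem heS heL (hSE e heS) hp (h01 e).2⟩
    · exact ⟨fun h => absurd h (not_mem_configOfLabels_affineRelabel_of_mem_of_not_mem heS heL hpb hb1 (h01 e).1 _),
        fun h => absurd h (hSL e heS heL)⟩
  · rw [mem_configOfLabels_affineRelabel_iff_of_not_mem heS, hoff e heS]

/-- `E(Γ_z) ⊆ S` as `Finset`s (for `z ∉ Γ` with a landing column). [cite: NewmanTassionWu2017, §4.1 (S(ω′) = B̄₁^#(z′) ∖ Γ_min(ω′))] -/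
theorem edgesFin_gammaZ_subset_surgFin {Γ : List (slab 3 k)} {z : slab 3 k}
    (hz : ∃ g ∈ Γ, planarAdj (planar k z) (planar k g)) (hzΓ : z ∉ Γ) :
    edgesFin k (gammaZ k Γ z) ⊆ surgFin k Γ (landCol k Γ z) := fun _ he =>
  mem_surgFin_iff.2 (edgesOf_gammaZ_subset_surgS hz hzΓ (mem_edgesFin_iff.1 he))

/-- `E(Γ_z) ∪ E(Γ_w) ⊆ S` as `Finset`s (for `z, w ∉ Γ`, `w` in an arm column). [cite: NewmanTassionWu2017, §4.1 (S(ω′) = B̄₁^#(z′) ∖ Γ_min(ω′))] -/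
theorem edgesFin_gammaZW_subset_surgFin {Γ : List (slab 3 k)} {z w : slab 3 k}
    (hz : ∃ g ∈ Γ, planarAdj (planar k z) (planar k g)) (hzΓ : z ∉ Γ)
    (hw : planarAdj (planar k w) (landCol k Γ z)) (hwΓ : w ∉ Γ) :
    edgesFin k (gammaZ k Γ z) ∪ edgesFin k (gammaW k Γ z w) ⊆ surgFin k Γ (landCol k Γ z) := by
  intro e he
  rcases Finset.mem_union.1 he with he | he
  · exact edgesFin_gammaZ_subset_surgFin hz hzΓ he
  · exact mem_surgFin_iff.2 (edgesOf_gammaW_subset_surgS hz hw hwΓ (mem_edgesFin_iff.1 he))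

/-- **`η_p(T U) = cfgZ`**: relabelling with `S` = the modified pairs and `L = E(Γ_z)` realises Steps 1 and 3.
[cite: NewmanTassionWu2017, §4.1 (proof of Lemma 4.1, Steps 1 and 3)] -/
theorem configOfLabels_surgeryZ {p b : ℝ} (hp : 0 ≤ p) (hpb : p < b) (hb1 : b ≤ 1)
    {U : Sym2 (slab 3 k) → ℝ} (h01 : ∀ e, U e ∈ Set.Icc (0 : ℝ) 1) {Γ : List (slab 3 k)} {z : slab 3 k}
    (hz : ∃ g ∈ Γ, planarAdj (planar k z) (planar k g)) (hzΓ : z ∉ Γ) :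
    configOfLabels p (affineRelabel p b (surgFin k Γ (landCol k Γ z)) (edgesFin k (gammaZ k Γ z)) U) (slabGraph 3 k) =
      cfgZ k (configOfLabels p U (slabGraph 3 k)) Γ z := by
  have hLS := edgesFin_gammaZ_subset_surgFin hz hzΓ
  refine configOfLabels_affineRelabel_eq hp hpb hb1 h01
    (fun e he => mem_edgeSet_of_mem_plusEdges (surgS_subset_plusEdges _ _ (mem_surgFin_iff.1 he)))
    (fun e he => ?_) (fun e he _ => Or.inr (mem_edgesFin_iff.1 he)) (fun e he heL => ?_)
  · rw [mem_surgFin_iff] at he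
    constructor
    · rintro (⟨h, -⟩ | h)
      · exact h
      · exact absurd (mem_surgFin_iff.1 (hLS (mem_edgesFin_iff.2 h))) he
    · exact fun h => Or.inl ⟨h, he⟩
  · rintro (⟨-, h⟩ | h)
    · exact h (mem_surgFin_iff.1 he)
    · exact heL (mem_edgesFin_iff.2 h)

/-- **`η_p(T U) = cfgZW`**: relabelling with `L = E(Γ_z) ∪ E(Γ_w)` realises Steps 1, 2 and 3.
[cite: NewmanTassionWu2017, §4.1 (proof of Lemma 4.1, Steps 1–3)] -/
theorem configOfLabels_surgeryZW {p b : ℝ} (hp : 0 ≤ p) (hpb : p < b) (hb1 : b ≤ 1)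
    {U : Sym2 (slab 3 k) → ℝ} (h01 : ∀ e, U e ∈ Set.Icc (0 : ℝ) 1) {Γ : List (slab 3 k)} {z w : slab 3 k}
    (hz : ∃ g ∈ Γ, planarAdj (planar k z) (planar k g)) (hzΓ : z ∉ Γ)
    (hw : planarAdj (planar k w) (landCol k Γ z)) (hwΓ : w ∉ Γ) :
    configOfLabels p (affineRelabel p b (surgFin k Γ (landCol k Γ z))
        (edgesFin k (gammaZ k Γ z) ∪ edgesFin k (gammaW k Γ z w)) U) (slabGraph 3 k) =
      cfgZW k (configOfLabels p U (slabGraph 3 k)) Γ z w := by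
  have hLS := edgesFin_gammaZW_subset_surgFin hz hzΓ hw hwΓ
  refine configOfLabels_affineRelabel_eq hp hpb hb1 h01
    (fun e he => mem_edgeSet_of_mem_plusEdges (surgS_subset_plusEdges _ _ (mem_surgFin_iff.1 he)))
    (fun e he => ?_) (fun e he _ => ?_) (fun e he heL => ?_)
  · rw [mem_surgFin_iff] at he
    constructor
    · rintro ((⟨h, -⟩ | h) | h)
      · exact h
      · exact absurd (mem_surgFin_iff.1 (hLS (Finset.mem_union_left _ (mem_edgesFin_iff.2 h)))) he
      · exact absurd (mem_surgFin_iff.1 (hLS (Finset.mem_union_right _ (mem_edgesFin_iff.2 h)))) he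
    · exact fun h => Or.inl (Or.inl ⟨h, he⟩)
  · rcases Finset.mem_union.1 he with h | h
    · exact Or.inl (Or.inr (mem_edgesFin_iff.1 h))
    · exact Or.inr (mem_edgesFin_iff.1 h)
  · rintro ((⟨-, h⟩ | h) | h)
    · exact h (mem_surgFin_iff.1 he)
    · exact heL (Finset.mem_union_left _ (mem_edgesFin_iff.2 h))
    · exact heL (Finset.mem_union_right _ (mem_edgesFin_iff.2 h))

/-- The relabelled field is `[0,1]`-valued (`0 ≤ p ≤ 1`, `0 ≤ b ≤ 1`). [cite: NewmanTassionWu2017, Lemma 4.2 (Φ : 𝓐 → 𝓑 ⊂ [0,1]^E)] -/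
theorem affineRelabel_mem_Icc {p b : ℝ} (hp : 0 ≤ p) (hp1 : p ≤ 1) (hb0 : 0 ≤ b) (hb1 : b ≤ 1)
    {U : Sym2 (slab 3 k) → ℝ} (h01 : ∀ e, U e ∈ Set.Icc (0 : ℝ) 1) (S L : Finset (Sym2 (slab 3 k))) :
    ∀ e, affineRelabel p b S L U e ∈ Set.Icc (0 : ℝ) 1 := fun e =>
  affineRelabel_apply_mem_Icc hp hp1 hb0 hb1 (h01 e)

/-- The relabelled field agrees with `U` off the plus pairs of the landing column (`S ⊆` plus pairs).
[cite: NewmanTassionWu2017, §4.1 ("ω|_{S^c} = ω′|_{S^c}")] -/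
theorem affineRelabel_agree_off_plusEdges {p b : ℝ} {U : Sym2 (slab 3 k) → ℝ} {Γ : List (slab 3 k)} {z : slab 3 k}
    (L : Finset (Sym2 (slab 3 k))) :
    ∀ e, e ∉ plusEdges k (landCol k Γ z) → U e = affineRelabel p b (surgFin k Γ (landCol k Γ z)) L U e := fun e he => by
  rw [affineRelabel_apply_of_not_mem fun heS => he (surgS_subset_plusEdges _ _ (mem_surgFin_iff.1 heS))]

/-! ## `w` is joined to `Γ` after Step 2 -/

/-- **After Step 2, `w` is joined to `Γ`**: along `Γ_w` to its end on `Γ_z ∪ Γ`, then along `Γ_z` to `Γ`.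
[cite: NewmanTassionWu2017, §4.1 (proof of Lemma 4.1, Step 2: "Γ_w … connecting w(ω) to Γ_min(ω) ∪ Γ_z")] -/
theorem exists_reachable_cfgZW {ω : BondConfig (slab 3 k)} {Γ : List (slab 3 k)} {z w : slab 3 k}
    (hz : ∃ g ∈ Γ, planarAdj (planar k z) (planar k g)) (hw : planarAdj (planar k w) (landCol k Γ z)) :
    ∃ g ∈ Γ, (openGraph (cfgZW k ω Γ z w)).Reachable w g := by
  obtain ⟨gw, hgw⟩ := exists_nearestOver_gammaW (w := w) hz
  obtain ⟨g, hg⟩ := exists_nearestOver_gammaZ hz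
  have hch : (gammaW k Γ z w).IsChain (fun a b => s(a, b) ∈ cfgZW k ω Γ z w ∧ a ≠ b) :=
    isChain_of_edgesOf_subset (connector_chain hgw hw) Set.subset_union_right
  have heq : gammaW k Γ z w = w :: vline k (landCol k Γ z) (ht w) (ht gw) := connector_eq hgw
  have hmem : gw ∈ gammaW k Γ z w := last_mem_connector hgw
  rw [heq] at hch hmem
  have hwgw : (openGraph (cfgZW k ω Γ z w)).Reachable w gw :=
    reachable_of_openConnIn (openConnIn_head_of_mem w _ hch (fun _ _ => Set.mem_univ _) gw hmem)
  rcases List.mem_append.1 (nearestOver_spec hgw).1 with hZ | hΓ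
  · exact ⟨g, (nearestOver_spec hg).1,
      hwgw.trans ((reachable_cfgZ_of_mem_gammaZ hz hg hZ).mono (openGraph_mono cfgZ_subset_cfgZW))⟩
  · exact ⟨gw, hΓ, hwgw⟩

/-! ## The surgery on one piece -/

section Piece

variable {p b : ℝ} {U U' : Sym2 (slab 3 k) → ℝ} {n N M : ℕ} {a x : slab 3 k} {Γ : List (slab 3 k)} {z w : slab 3 k}

/-- The roots: a vertex over `B_{n-1}` lies off the plus cylinder about any column of a circuit of `Ā_{n,N}` (whose columns have
sup-norm `> n`). [cite: NewmanTassionWu2017, §4.1 (Lemma 4.1: x ∈ B̄_{m_{i₀}}, i > i₀)] -/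
theorem mem_wDom_of_planar_mem_sqBox {ω : BondConfig (slab 3 k)}
    (hΓ : IsOpenCircuit k ω (slabLift k (annulus ((0 : ℤ), (0 : ℤ)) n N)) Γ) (hn : 1 ≤ n) (hnM : n ≤ M + 1)
    (hz : ∃ g ∈ Γ, planarAdj (planar k z) (planar k g)) (hx : planar k x ∈ sqBox ((0 : ℤ), (0 : ℤ)) (n - 1)) :
    x ∈ wDom k Γ z M := by
  rw [mem_wDom_iff]
  refine ⟨sqBox_mono _ (by omega) hx, fun hP => ?_⟩
  obtain ⟨g, hgΓ, hgy⟩ := (landCol_spec hz).1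
  have hy : landCol k Γ z ∈ annulus ((0 : ℤ), (0 : ℤ)) n N := by rw [← hgy]; exact hΓ.subset g hgΓ
  have hq : planar k x ∈ sqBox (landCol k Γ z) 1 := plusCols_subset_sqBox _ hP
  have hy' : landCol k Γ z ∈ sqBox (planar k x) 1 := by
    rw [mem_sqBox_iff'] at hq ⊢; omega
  have : landCol k Γ z ∈ sqBox ((0 : ℤ), (0 : ℤ)) (n - 1 + 1) := mem_sqBox_add hx hy'
  rw [Nat.sub_add_cancel hn] at this
  exact hy.2 this

/-- **The surgery of Steps 1 and 3 on `(𝓑_a)^c ∩ C ∩ D′`.**  With `Γ = Γ_min(η_p(U))`, `z = zHat`, `S = surgFin Γ z′`, `L = E(Γ_z)`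
and `U' = T_{S,L} U`: the new configuration is `cfgZ`, still has a surrounding open circuit in `Ā_{n,N}`, still avoids
`B_{N+1} ⟷^{B_{M+1}} ∂B_{M+1}`, has the SAME minimal circuit and the SAME landing vertex, and **`𝓑_a(U')` holds**.
[cite: NewmanTassionWu2017, §4.1 (proof of Lemma 4.1: "By construction, ω′ ∈ 𝓑_0^{m_i} ∩ … 𝒴_A^i", (f2) Γ_min(ω′) = Γ_min(ω), z(ω) = z(ω′))] -/
theorem surgeryZ_spec (hp : 0 ≤ p) (hpb : p < b) (hb1 : b ≤ 1) (h01 : ∀ e, U e ∈ Set.Icc (0 : ℝ) 1)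
    (hn : 1 ≤ n) (hnN : n ≤ N) (hNM : N + 1 ≤ M)
    (hC : configOfLabels p U (slabGraph 3 k) ∈ circuitAround k ((0 : ℤ), (0 : ℤ)) n N)
    (hD : configOfLabels p U (slabGraph 3 k) ∉
      slabConn k (sqBox ((0 : ℤ), (0 : ℤ)) (M + 1)) (sqBox ((0 : ℤ), (0 : ℤ)) (N + 1)) (sqSphere ((0 : ℤ), (0 : ℤ)) (M + 1)))
    (hΓ : Γ = minCircuit k (configOfLabels p U (slabGraph 3 k)) ((0 : ℤ), (0 : ℤ)) n N)
    (ha : planar k a ∈ sqBox ((0 : ℤ), (0 : ℤ)) (n - 1)) (hz : z = zHat k Γ N U a)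
    (hnotB : ¬ ∀ g ∈ Γ, g ∈ invasion (slabGraph 3 k) U a (exitIndex (slabGraph 3 k) U a (ballFinset k ((0 : ℤ), (0 : ℤ)) M)))
    (hU' : U' = affineRelabel p b (surgFin k Γ (landCol k Γ z)) (edgesFin k (gammaZ k Γ z)) U) :
    configOfLabels p U' (slabGraph 3 k) = cfgZ k (configOfLabels p U (slabGraph 3 k)) Γ z ∧
      configOfLabels p U' (slabGraph 3 k) ∈ circuitAround k ((0 : ℤ), (0 : ℤ)) n N ∧
      configOfLabels p U' (slabGraph 3 k) ∉
        slabConn k (sqBox ((0 : ℤ), (0 : ℤ)) (M + 1)) (sqBox ((0 : ℤ), (0 : ℤ)) (N + 1)) (sqSphere ((0 : ℤ), (0 : ℤ)) (M + 1)) ∧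
      minCircuit k (configOfLabels p U' (slabGraph 3 k)) ((0 : ℤ), (0 : ℤ)) n N = Γ ∧
      zHat k Γ N U' a = z ∧
      ∀ g ∈ Γ, g ∈ invasion (slabGraph 3 k) U' a (exitIndex (slabGraph 3 k) U' a (ballFinset k ((0 : ℤ), (0 : ℤ)) M)) := by
  set η := configOfLabels p U (slabGraph 3 k) with hη
  have hω : η ⊆ (slabGraph 3 k).edgeSet := fun _ h => h.1
  obtain ⟨⟨hΓo, hs⟩, -⟩ := minCircuit_spec hC
  rw [← hΓ] at hΓo hs
  have haF : a ∈ insideFin k Γ N := mem_insideFin_of_planar_mem_sqBox hΓo hn hnN ha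
  have hzadj : ∃ g ∈ Γ, planarAdj (planar k z) (planar k g) := hz ▸ exists_planarAdj_zHat hω hΓo hs haF
  have hzΓ : z ∉ Γ := hz ▸ zHat_not_mem hω hΓo hs haF
  have hy : ∃ g ∈ Γ, planar k g = landCol k Γ z := (landCol_spec hzadj).1
  have hyN : landCol k Γ z ∈ sqBox ((0 : ℤ), (0 : ℤ)) N := landCol_mem_sqBox hΓo hzadj
  have hf1 : ∀ g ∈ Γ, ¬ (openGraph η).Reachable z g := hz ▸ not_reachable_zHat hNM hΓo hs hD haF hnotB
  -- the new configuration
  have hη' : configOfLabels p U' (slabGraph 3 k) = cfgZ k η Γ z := hU' ▸ configOfLabels_surgeryZ hp hpb hb1 h01 hzadj hzΓ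
  have hD' : configOfLabels p U' (slabGraph 3 k) ∉
      slabConn k (sqBox ((0 : ℤ), (0 : ℤ)) (M + 1)) (sqBox ((0 : ℤ), (0 : ℤ)) (N + 1)) (sqSphere ((0 : ℤ), (0 : ℤ)) (M + 1)) := by
    rw [hη']
    exact not_mem_slabConn_of_new_pairs (fun e he hne v hv =>
      planar_mem_sqBox_succ_of_mem_plusEdges hyN (mem_plusEdges_of_mem_cfgZ_of_not_mem hzadj he hne) hv) hD
  have hΓ' : IsOpenCircuit k (configOfLabels p U' (slabGraph 3 k)) (slabLift k (annulus ((0 : ℤ), (0 : ℤ)) n N)) Γ := by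
    rw [hη']; exact isOpenCircuit_cfgZ hΓo
  have hagree : ∀ e, e ∉ plusEdges k (landCol k Γ z) → U e = U' e := hU' ▸ affineRelabel_agree_off_plusEdges _
  obtain ⟨hzeq, -, hinv⟩ := zHat_congr hy hagree haF
  -- `z` belongs to the stopped invasion of the new field, and is joined to `Γ` along `Γ_z`
  have hzI' : z ∈ invasion (slabGraph 3 k) U' a (exitIndex (slabGraph 3 k) U' a (ballFinset k ((0 : ℤ), (0 : ℤ)) M)) :=
    mem_stoppedInvasion_of_agree (exists_not_subset_invasion_slab U' a _) hinv
      (invasion_zIndex_subset_ballFinset hω hΓo hs haF ((Nat.le_succ N).trans hNM)) (hz ▸ zHat_mem_invasion hω hΓo hs haF)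
  obtain ⟨g, hg⟩ := exists_nearestOver_gammaZ hzadj
  have hreach : (openGraph (configOfLabels p U' (slabGraph 3 k))).Reachable z g := by
    rw [hη']; exact reachable_cfgZ_of_mem_gammaZ hzadj hg (mem_connector_self _ _ _)
  refine ⟨hη', hη' ▸ cfgZ_mem_circuitAround hC hΓ, hD', hη' ▸ minCircuit_cfgZ hω hC hΓ hzadj hf1, hz ▸ hzeq, ?_⟩
  exact forall_mem_stoppedInvasion_of_reachable hNM hD' hΓ'
    (sqBox_mono _ (Nat.le_succ N) (hz ▸ planar_zHat_mem_sqBox hω hΓo hs haF)) hzI' (nearestOver_spec hg).1 hreach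

/-- **`𝓑_x` after Steps 1 and 3 when the Step-2 test fails.**  If moreover `𝓑_x(U)` holds, `x̄ ∈ B_{n-1}`, `w = wHat`, and
some vertex of `Γ` IS joined to `w` in `cfgZ` (so `Γ_w` is not added), then `𝓑_x(U')` holds: `w` is invaded by the new field
before its break-out of `Λ_M` (locality off the plus pairs), lies over `B_{N+1}`, and blocked absorption applies.
[cite: NewmanTassionWu2017, §4.1 (proof of Lemma 4.1, Step 2: "If w ∈ C_{p_c}(z), go to Step 3" and "ω′ ∈ 𝓑_x^{m_i}")] -/
theorem surgeryZ_Bx (hp : 0 ≤ p) (hpb : p < b) (hb1 : b ≤ 1) (h01 : ∀ e, U e ∈ Set.Icc (0 : ℝ) 1)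
    (hn : 1 ≤ n) (hnN : n ≤ N) (hNM : N + 1 ≤ M)
    (hC : configOfLabels p U (slabGraph 3 k) ∈ circuitAround k ((0 : ℤ), (0 : ℤ)) n N)
    (hD : configOfLabels p U (slabGraph 3 k) ∉
      slabConn k (sqBox ((0 : ℤ), (0 : ℤ)) (M + 1)) (sqBox ((0 : ℤ), (0 : ℤ)) (N + 1)) (sqSphere ((0 : ℤ), (0 : ℤ)) (M + 1)))
    (hΓ : Γ = minCircuit k (configOfLabels p U (slabGraph 3 k)) ((0 : ℤ), (0 : ℤ)) n N)
    (ha : planar k a ∈ sqBox ((0 : ℤ), (0 : ℤ)) (n - 1)) (hz : z = zHat k Γ N U a)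
    (hnotB : ¬ ∀ g ∈ Γ, g ∈ invasion (slabGraph 3 k) U a (exitIndex (slabGraph 3 k) U a (ballFinset k ((0 : ℤ), (0 : ℤ)) M)))
    (hU' : U' = affineRelabel p b (surgFin k Γ (landCol k Γ z)) (edgesFin k (gammaZ k Γ z)) U)
    (hx : planar k x ∈ sqBox ((0 : ℤ), (0 : ℤ)) (n - 1))
    (hBx : ∀ g ∈ Γ, g ∈ invasion (slabGraph 3 k) U x (exitIndex (slabGraph 3 k) U x (ballFinset k ((0 : ℤ), (0 : ℤ)) M)))
    (hw : w = wHat k Γ z M U x)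
    (hnotest : ¬ ∀ g ∈ Γ, ¬ (openGraph (cfgZ k (configOfLabels p U (slabGraph 3 k)) Γ z)).Reachable w g) :
    ∀ g ∈ Γ, g ∈ invasion (slabGraph 3 k) U' x (exitIndex (slabGraph 3 k) U' x (ballFinset k ((0 : ℤ), (0 : ℤ)) M)) := by
  obtain ⟨hη', -, hD', -, -, -⟩ := surgeryZ_spec hp hpb hb1 h01 hn hnN hNM hC hD hΓ ha hz hnotB hU'
  set η := configOfLabels p U (slabGraph 3 k) with hη
  have hω : η ⊆ (slabGraph 3 k).edgeSet := fun _ h => h.1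
  obtain ⟨⟨hΓo, hs⟩, -⟩ := minCircuit_spec hC
  rw [← hΓ] at hΓo hs
  have haF : a ∈ insideFin k Γ N := mem_insideFin_of_planar_mem_sqBox hΓo hn hnN ha
  have hzadj : ∃ g ∈ Γ, planarAdj (planar k z) (planar k g) := hz ▸ exists_planarAdj_zHat hω hΓo hs haF
  have hyN : landCol k Γ z ∈ sqBox ((0 : ℤ), (0 : ℤ)) N := landCol_mem_sqBox hΓo hzadj
  have hxW : x ∈ wDom k Γ z M := mem_wDom_of_planar_mem_sqBox hΓo hn (by omega) hzadj hx
  have hΓ' : IsOpenCircuit k (configOfLabels p U' (slabGraph 3 k)) (slabLift k (annulus ((0 : ℤ), (0 : ℤ)) n N)) Γ := by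
    rw [hη']; exact isOpenCircuit_cfgZ hΓo
  have hagree : ∀ e, e ∉ plusEdges k (landCol k Γ z) → U e = U' e := hU' ▸ affineRelabel_agree_off_plusEdges _
  obtain ⟨-, hwI, hIσ, hwP, -⟩ := wHat_spec hΓo ((Nat.le_succ N).trans hNM) hzadj hxW hBx
  obtain ⟨-, -, hinvx⟩ := wHat_congr (M := M) hagree hxW
  have hwI' : w ∈ invasion (slabGraph 3 k) U' x (exitIndex (slabGraph 3 k) U' x (ballFinset k ((0 : ℤ), (0 : ℤ)) M)) :=
    mem_stoppedInvasion_of_agree (exists_not_subset_invasion_slab U' x _) hinvx hIσ (hw ▸ hwI)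
  have hwN1 : planar k w ∈ sqBox ((0 : ℤ), (0 : ℤ)) (N + 1) := planar_mem_sqBox_succ_of_mem_plusCyl hyN (hw ▸ hwP)
  obtain ⟨g, hgΓ, hreach⟩ : ∃ g ∈ Γ, (openGraph (cfgZ k η Γ z)).Reachable w g := by
    by_contra h
    push Not at h
    exact hnotest h
  rw [← hη'] at hreach
  exact forall_mem_stoppedInvasion_of_reachable hNM hD' hΓ' hwN1 hwI' hgΓ hreach

/-- **The surgery of Steps 1, 2 and 3 on `(𝓑_a)^c ∩ 𝓑_x ∩ C ∩ D′` when the Step-2 test holds** (no vertex of `Γ` is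
`cfgZ`-joined to `w`; `L = E(Γ_z) ∪ E(Γ_w)`): the new configuration is `cfgZW`, `C`, `D′`, `Γ_min`, the landing vertex are
preserved, and `𝓑_a(U')` holds. [cite: NewmanTassionWu2017, §4.1 (proof of Lemma 4.1, Steps 1–3, (f2) with Step 2)] -/
theorem surgeryZW_spec (hp : 0 ≤ p) (hpb : p < b) (hb1 : b ≤ 1) (h01 : ∀ e, U e ∈ Set.Icc (0 : ℝ) 1)
    (hn : 1 ≤ n) (hnN : n ≤ N) (hNM : N + 1 ≤ M)
    (hC : configOfLabels p U (slabGraph 3 k) ∈ circuitAround k ((0 : ℤ), (0 : ℤ)) n N)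
    (hD : configOfLabels p U (slabGraph 3 k) ∉
      slabConn k (sqBox ((0 : ℤ), (0 : ℤ)) (M + 1)) (sqBox ((0 : ℤ), (0 : ℤ)) (N + 1)) (sqSphere ((0 : ℤ), (0 : ℤ)) (M + 1)))
    (hΓ : Γ = minCircuit k (configOfLabels p U (slabGraph 3 k)) ((0 : ℤ), (0 : ℤ)) n N)
    (ha : planar k a ∈ sqBox ((0 : ℤ), (0 : ℤ)) (n - 1)) (hz : z = zHat k Γ N U a)
    (hnotB : ¬ ∀ g ∈ Γ, g ∈ invasion (slabGraph 3 k) U a (exitIndex (slabGraph 3 k) U a (ballFinset k ((0 : ℤ), (0 : ℤ)) M)))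
    (hx : planar k x ∈ sqBox ((0 : ℤ), (0 : ℤ)) (n - 1))
    (hBx : ∀ g ∈ Γ, g ∈ invasion (slabGraph 3 k) U x (exitIndex (slabGraph 3 k) U x (ballFinset k ((0 : ℤ), (0 : ℤ)) M)))
    (hw : w = wHat k Γ z M U x)
    (htest : ∀ g ∈ Γ, ¬ (openGraph (cfgZ k (configOfLabels p U (slabGraph 3 k)) Γ z)).Reachable w g)
    (hU' : U' = affineRelabel p b (surgFin k Γ (landCol k Γ z))
      (edgesFin k (gammaZ k Γ z) ∪ edgesFin k (gammaW k Γ z w)) U) :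
    configOfLabels p U' (slabGraph 3 k) = cfgZW k (configOfLabels p U (slabGraph 3 k)) Γ z w ∧
      configOfLabels p U' (slabGraph 3 k) ∈ circuitAround k ((0 : ℤ), (0 : ℤ)) n N ∧
      configOfLabels p U' (slabGraph 3 k) ∉
        slabConn k (sqBox ((0 : ℤ), (0 : ℤ)) (M + 1)) (sqBox ((0 : ℤ), (0 : ℤ)) (N + 1)) (sqSphere ((0 : ℤ), (0 : ℤ)) (M + 1)) ∧
      minCircuit k (configOfLabels p U' (slabGraph 3 k)) ((0 : ℤ), (0 : ℤ)) n N = Γ ∧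
      zHat k Γ N U' a = z ∧
      (∀ g ∈ Γ, g ∈ invasion (slabGraph 3 k) U' a (exitIndex (slabGraph 3 k) U' a (ballFinset k ((0 : ℤ), (0 : ℤ)) M))) ∧
      ∀ g ∈ Γ, g ∈ invasion (slabGraph 3 k) U' x (exitIndex (slabGraph 3 k) U' x (ballFinset k ((0 : ℤ), (0 : ℤ)) M)) := by
  set η := configOfLabels p U (slabGraph 3 k) with hη
  have hω : η ⊆ (slabGraph 3 k).edgeSet := fun _ h => h.1
  obtain ⟨⟨hΓo, hs⟩, -⟩ := minCircuit_spec hC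
  rw [← hΓ] at hΓo hs
  have haF : a ∈ insideFin k Γ N := mem_insideFin_of_planar_mem_sqBox hΓo hn hnN ha
  have hzadj : ∃ g ∈ Γ, planarAdj (planar k z) (planar k g) := hz ▸ exists_planarAdj_zHat hω hΓo hs haF
  have hzΓ : z ∉ Γ := hz ▸ zHat_not_mem hω hΓo hs haF
  have hy : ∃ g ∈ Γ, planar k g = landCol k Γ z := (landCol_spec hzadj).1
  have hyN : landCol k Γ z ∈ sqBox ((0 : ℤ), (0 : ℤ)) N := landCol_mem_sqBox hΓo hzadj
  have hf1 : ∀ g ∈ Γ, ¬ (openGraph η).Reachable z g := hz ▸ not_reachable_zHat hNM hΓo hs hD haF hnotB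
  have hxW : x ∈ wDom k Γ z M := mem_wDom_of_planar_mem_sqBox hΓo hn (by omega) hzadj hx
  obtain ⟨-, hwI, hIσ, hwP, hwadj⟩ := wHat_spec hΓo ((Nat.le_succ N).trans hNM) hzadj hxW hBx
  rw [← hw] at hwI hwP hwadj
  have hwΓ : w ∉ Γ := fun h => htest w h (SimpleGraph.Reachable.refl _)
  -- the new configuration
  have hη' : configOfLabels p U' (slabGraph 3 k) = cfgZW k η Γ z w :=
    hU' ▸ configOfLabels_surgeryZW hp hpb hb1 h01 hzadj hzΓ hwadj hwΓ
  have hD' : configOfLabels p U' (slabGraph 3 k) ∉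
      slabConn k (sqBox ((0 : ℤ), (0 : ℤ)) (M + 1)) (sqBox ((0 : ℤ), (0 : ℤ)) (N + 1)) (sqSphere ((0 : ℤ), (0 : ℤ)) (M + 1)) := by
    rw [hη']
    exact not_mem_slabConn_of_new_pairs (fun e he hne v hv =>
      planar_mem_sqBox_succ_of_mem_plusEdges hyN (mem_plusEdges_of_mem_cfgZW_of_not_mem hzadj hwadj he hne) hv) hD
  have hΓ' : IsOpenCircuit k (configOfLabels p U' (slabGraph 3 k)) (slabLift k (annulus ((0 : ℤ), (0 : ℤ)) n N)) Γ := by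
    rw [hη']; exact isOpenCircuit_cfgZW hΓo
  have hagree : ∀ e, e ∉ plusEdges k (landCol k Γ z) → U e = U' e := hU' ▸ affineRelabel_agree_off_plusEdges _
  obtain ⟨hzeq, -, hinv⟩ := zHat_congr hy hagree haF
  -- `𝓑_a(U')`: `z` is invaded and joined to `Γ` along `Γ_z`
  have hzI' : z ∈ invasion (slabGraph 3 k) U' a (exitIndex (slabGraph 3 k) U' a (ballFinset k ((0 : ℤ), (0 : ℤ)) M)) :=
    mem_stoppedInvasion_of_agree (exists_not_subset_invasion_slab U' a _) hinv
      (invasion_zIndex_subset_ballFinset hω hΓo hs haF ((Nat.le_succ N).trans hNM)) (hz ▸ zHat_mem_invasion hω hΓo hs haF)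
  obtain ⟨g, hg⟩ := exists_nearestOver_gammaZ hzadj
  have hreachz : (openGraph (configOfLabels p U' (slabGraph 3 k))).Reachable z g := by
    rw [hη']
    exact (reachable_cfgZ_of_mem_gammaZ hzadj hg (mem_connector_self _ _ _)).mono (openGraph_mono cfgZ_subset_cfgZW)
  have hBa : ∀ g ∈ Γ, g ∈ invasion (slabGraph 3 k) U' a (exitIndex (slabGraph 3 k) U' a (ballFinset k ((0 : ℤ), (0 : ℤ)) M)) :=
    forall_mem_stoppedInvasion_of_reachable hNM hD' hΓ'
      (sqBox_mono _ (Nat.le_succ N) (hz ▸ planar_zHat_mem_sqBox hω hΓo hs haF)) hzI' (nearestOver_spec hg).1 hreachz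
  -- `𝓑_x(U')`: `w` is invaded and joined to `Γ` along `Γ_w` (then `Γ_z`)
  obtain ⟨-, -, hinvx⟩ := wHat_congr (M := M) hagree hxW
  have hwI' : w ∈ invasion (slabGraph 3 k) U' x (exitIndex (slabGraph 3 k) U' x (ballFinset k ((0 : ℤ), (0 : ℤ)) M)) :=
    mem_stoppedInvasion_of_agree (exists_not_subset_invasion_slab U' x _) hinvx hIσ hwI
  have hwN1 : planar k w ∈ sqBox ((0 : ℤ), (0 : ℤ)) (N + 1) := planar_mem_sqBox_succ_of_mem_plusCyl hyN hwP
  obtain ⟨g', hg'Γ, hreachw⟩ := exists_reachable_cfgZW (ω := η) hzadj hwadj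
  rw [← hη'] at hreachw
  refine ⟨hη', hη' ▸ cfgZW_mem_circuitAround hC hΓ, hD', hη' ▸ minCircuit_cfgZW hω hC hΓ hzadj hwadj hf1 htest,
    hz ▸ hzeq, hBa, ?_⟩
  exact forall_mem_stoppedInvasion_of_reachable hNM hD' hΓ' hwN1 hwI' hg'Γ hreachw

end Piece

end Summit.CriticalPhenomena.PercolationContinuityZ3.Theorems.Crossing
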